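/-
Copyright (c) 2026 the pub-hodgecm-mathlib formalisation cell (harness21).  Prover seat hodgecm-mathlib-K2E5-p16 (g6), Track B «K2-LIT»,
#184♮ = hLiu418 = `stmt-HodgeConjecture-24832`; F7 inert-witness organ (K2Liu-p01 (g9) RECIPE v2 80571dd96a2cf31d §A∕§C, cut (α) = the (W3) FRONT HALF
`hf₀out` ABSTRACT LETTER; dealt by K2E5-plan (g7) 13:54:02Z): a smooth section vanishing off the big cell has profile `n ↦ f (w n)` VANISHING OUTSIDE A
BOX OF FINITE LEVEL — ★ F3b (L0) `exists_compact_profile_support` composed with ★ (I) `exists_nat_level_of_compact_support`, at the abstract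
topological-group level, plus the `F₊ + μ F₋` form the packaging plugs.  THEOREMS ONLY (no `def`, no `instance`, no notation, no `sorry`).
-/
import Summits.HodgeConjecture.HodgeConjecture.Theorems.K2LiuLocalSWSpanningCriterion   -- ★ F3b (L0) `exists_compact_profile_support`
import Summits.HodgeConjecture.HodgeConjecture.Theorems.K2LiuProfileSupportLevel        -- ★ (I) `exists_nat_level_of_compact_support`
import HarnessLib

/-!
# Crux `HLiu418`, F7 inert witness, cut (α): the profile of a big-cell section vanishes outside a box of finite level

Cell `hodgecm-mathlib`, crux item hLiu418 = `stmt-HodgeConjecture-24832` (helper lane `--supports`, count-neutral).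

GENERIC (any topological group `G`, subgroups `P, N`, Weyl element `w`, Iwasawa compact `K₀`, `N`-coordinate `ν` on `Ω = P·w·N`, a «box» family
`box : ℤ → Set M` read through a coordinate `B : G → M` continuous on `N`):
* **`exists_nat_level_of_profile`** — for `f` with left law `χ`, right-invariant under an open subgroup, vanishing off `Ω` (`hfoff` BY VALUE, RECIPE §C(G)):
  `∃ M₀ : ℕ, ∀ n ∈ N, B n ∉ box M₀ → f (w * n) = 0` (= `hf₀out`);
* `law_add_smul`, `smooth_add_smul` — the law and the smoothness of `F₊ + μ·F₋` from those of `F₊, F₋`;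
* **`exists_nat_level_of_profile_add_smul`** — the same for `f := F₊ + μ·F₋` (the shape the (W3) packaging plugs, `M₀` depending on `μ`).
The concrete reading (`N := N_Δ`, `n := nElem t`, `B := blkB ∘ matA`, `box := BOX`) is one `exact` in K2Liu-p01's (W3).
References: [BernsteinZelevinsky1976, §1.5]; [Casselman1995, §3]; [MoeglinVignerasWaldspurger1987, Ch. 1 I.17].
HONEST LABEL: HC_CM is proved only modulo the 7 printed citations (2 remaining named inputs: hLiu418 = stmt-HodgeConjecture-24832,
h413 = stmt-HodgeConjecture-24833) until rung 0 closes; count-neutral helper, closes no socket.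
-/

set_option autoImplicit false
set_option linter.dupNamespace false

noncomputable section

namespace Summit.HodgeConjecture.HodgeConjecture.Cruxes.HLiu418.K2LiuProfileSupportOutsideBox

open Summit.HodgeConjecture.HodgeConjecture.Cruxes.HLiu418.K2LiuLocalSWSpanningCriterion (exists_compact_profile_support)
open Summit.HodgeConjecture.HodgeConjecture.Cruxes.HLiu418.K2LiuProfileSupportLevel (exists_nat_level_of_compact_support)

variable {G M : Type*} [Group G] [TopologicalSpace G] [IsTopologicalGroup G] [TopologicalSpace M]

/-- **`hf₀out` (ABSTRACT)**: a section with left law `χ`, smooth (right-invariant under an open subgroup) and vanishing off the big cell `Ω = P·w·N`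
has profile `n ↦ f (w·n)` vanishing outside a box of some finite level `M₀`, for ANY monotone exhaustive family of open boxes read through a
coordinate `B` continuous on `N` (★ (L0) + ★ (I)). [cite: BernsteinZelevinsky1976, §1.5] [cite: Casselman1995, §3] -/
theorem exists_nat_level_of_profile {P N : Subgroup G} {χ : G → ℂ} {K₀ : Set G} (hK₀ : IsCompact K₀)
    (hIw : ∀ g : G, ∃ p ∈ P, ∃ k ∈ K₀, g = p * k)
    {w : G} {ν : G → G} (hνc : ContinuousOn ν {h | ∃ p ∈ P, ∃ n ∈ N, h = p * w * n})
    (hν : ∀ p ∈ P, ∀ n ∈ N, ν (p * w * n) = n) {f : G → ℂ} (hf : ∀ p ∈ P, ∀ h, f (p * h) = χ p * f h)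
    (hfs : ∃ V : Subgroup G, IsOpen (V : Set G) ∧ ∀ h, ∀ u ∈ V, f (h * u) = f h)
    (hfoff : ∀ h, (¬ ∃ p ∈ P, ∃ n ∈ N, h = p * w * n) → f h = 0)
    (B : G → M) (hB : ContinuousOn B (N : Set G)) {box : ℤ → Set M} (hmono : Monotone box) (hopen : ∀ m, IsOpen (box m))
    (hex : ∀ t, ∃ m, t ∈ box m) :
    ∃ M₀ : ℕ, ∀ n ∈ N, B n ∉ box (M₀ : ℤ) → f (w * n) = 0 := by
  obtain ⟨S₀, hS₀, hS₀N, hS⟩ := exists_compact_profile_support hK₀ hIw hνc hν hf hfs hfoff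
  exact exists_nat_level_of_compact_support B hB hmono hopen hex hS₀ hS₀N (F := fun n => f (w * n)) hS

omit [TopologicalSpace G] [IsTopologicalGroup G] in
/-- the left law is additive-linear: `F₊ + μ·F₋` has law `χ` if `F₊, F₋` do. [folklore] -/
theorem law_add_smul {P : Subgroup G} {χ : G → ℂ} {F₁ F₂ : G → ℂ} (h₁ : ∀ p ∈ P, ∀ h, F₁ (p * h) = χ p * F₁ h)
    (h₂ : ∀ p ∈ P, ∀ h, F₂ (p * h) = χ p * F₂ h) (μ : ℂ) :
    ∀ p ∈ P, ∀ h, (fun g => F₁ g + μ * F₂ g) (p * h) = χ p * (fun g => F₁ g + μ * F₂ g) h := by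
  intro p hp h
  simp only [h₁ p hp h, h₂ p hp h]
  ring

omit [IsTopologicalGroup G] in
/-- smoothness is additive: `F₊ + μ·F₋` is right-invariant under the open subgroup `V₊ ⊓ V₋`. [folklore] -/
theorem smooth_add_smul {F₁ F₂ : G → ℂ} (h₁ : ∃ V : Subgroup G, IsOpen (V : Set G) ∧ ∀ h, ∀ u ∈ V, F₁ (h * u) = F₁ h)
    (h₂ : ∃ V : Subgroup G, IsOpen (V : Set G) ∧ ∀ h, ∀ u ∈ V, F₂ (h * u) = F₂ h) (μ : ℂ) :
    ∃ V : Subgroup G, IsOpen (V : Set G) ∧ ∀ h, ∀ u ∈ V, (fun g => F₁ g + μ * F₂ g) (h * u) = (fun g => F₁ g + μ * F₂ g) h := by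
  obtain ⟨V₁, hV₁o, hV₁⟩ := h₁
  obtain ⟨V₂, hV₂o, hV₂⟩ := h₂
  refine ⟨V₁ ⊓ V₂, ?_, fun h u hu => ?_⟩
  · -- `V₁ ⊓ V₂` is an open subgroup: it contains the open neighbourhood `V₁ ∩ V₂` of every point as a coset-free intersection
    have : ((V₁ ⊓ V₂ : Subgroup G) : Set G) = (V₁ : Set G) ∩ (V₂ : Set G) := Subgroup.coe_inf V₁ V₂
    rw [this]
    exact hV₁o.inter hV₂o
  · have hu' : u ∈ V₁ ∧ u ∈ V₂ := Subgroup.mem_inf.1 hu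
    simp only [hV₁ h u hu'.1, hV₂ h u hu'.2]

/-- **`hf₀out` FOR `f := F₊ + μ·F₋`** (the shape RECIPE v2 §A plugs): laws and smoothness of `F₊, F₋` separately, the off-cell vanishing of the
COMBINATION by value (§C(G)); conclusion `∃ M₀, ∀ n ∈ N, B n ∉ box M₀ → F₊ (w n) + μ F₋ (w n) = 0` (`M₀` depends on `μ`).
[cite: BernsteinZelevinsky1976, §1.5] [cite: Casselman1995, §3] -/
theorem exists_nat_level_of_profile_add_smul {P N : Subgroup G} {χ : G → ℂ} {K₀ : Set G} (hK₀ : IsCompact K₀)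
    (hIw : ∀ g : G, ∃ p ∈ P, ∃ k ∈ K₀, g = p * k)
    {w : G} {ν : G → G} (hνc : ContinuousOn ν {h | ∃ p ∈ P, ∃ n ∈ N, h = p * w * n})
    (hν : ∀ p ∈ P, ∀ n ∈ N, ν (p * w * n) = n) {F₁ F₂ : G → ℂ} (μ : ℂ)
    (hF₁ : ∀ p ∈ P, ∀ h, F₁ (p * h) = χ p * F₁ h) (hF₂ : ∀ p ∈ P, ∀ h, F₂ (p * h) = χ p * F₂ h)
    (hF₁s : ∃ V : Subgroup G, IsOpen (V : Set G) ∧ ∀ h, ∀ u ∈ V, F₁ (h * u) = F₁ h)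
    (hF₂s : ∃ V : Subgroup G, IsOpen (V : Set G) ∧ ∀ h, ∀ u ∈ V, F₂ (h * u) = F₂ h)
    (hfoff : ∀ h, (¬ ∃ p ∈ P, ∃ n ∈ N, h = p * w * n) → F₁ h + μ * F₂ h = 0)
    (B : G → M) (hB : ContinuousOn B (N : Set G)) {box : ℤ → Set M} (hmono : Monotone box) (hopen : ∀ m, IsOpen (box m))
    (hex : ∀ t, ∃ m, t ∈ box m) :
    ∃ M₀ : ℕ, ∀ n ∈ N, B n ∉ box (M₀ : ℤ) → F₁ (w * n) + μ * F₂ (w * n) = 0 :=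
  exists_nat_level_of_profile (f := fun g => F₁ g + μ * F₂ g) hK₀ hIw hνc hν (law_add_smul hF₁ hF₂ μ) (smooth_add_smul hF₁s hF₂s μ)
    hfoff B hB hmono hopen hex

end Summit.HodgeConjecture.HodgeConjecture.Cruxes.HLiu418.K2LiuProfileSupportOutsideBox

end
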